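import Summits.SmoothPoincare4.SmoothPoincare4.Theorems.ShadowApproximation.Negative.ShadowsOnlyFalse

/-!
# `ShadowApproximation` — negative-side support II: which trisection conditions the junk violates

Continuation of `Negative/ShadowsOnlyFalse.lean` (crux `CongruenceShadows.ShadowApproximation`,
stmt-SmoothPoincare4-14595; standing disprover's `Cruxes/ShadowApproximation/Disproof.lean` §3).
For the junk triple `J = (N₀, N₁, J₂)`, `J₂ = N₂ ⊓ ker θ` (all finite shadows standard, `¬ Iso N J`):

* HOLD: `normal`, `free_quotient 0, 1` (`junk_free_quotient_01`), `free_pairQuotient (0,1)` AND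
  `(1,2)` (`junk_free_pairQuotient_01/12`, via `N1_sup_J2 : N₁ ⊔ J₂ = N₁ ⊔ N₂` — the word
  `w₄ = (b₀ · b₁b₀b₁⁻¹)² ∈ J₂` has `b₀`-exponent `4` while `b₀³ ∈ J₂`), and `triple`
  (`junk_triple : S₃ ⧸ ⟪J₀ ∪ J₁ ∪ J₂⟫ ≃* PUnit`, i.e. "`π₁ = 1`").
* FAIL: `free_quotient 2` (`junk_not_free_quotient_two`, any rank) and `free_pairQuotient (0,2)`
  (`junk_not_free_pairQuotient_02`, any rank): `3`-torsion from the class of `b₀`.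

Moral for provers of the crux: beyond the congruence data, a proof must use the FREENESS of
`S ⧸ K₂` or of one pair quotient `S ⧸ KᵢKⱼ`; simple connectivity (`triple`) and normality do not
suffice, even together with level-wise EQUAL shadows.
-/

noncomputable section

namespace Summit.SmoothPoincare4.SmoothPoincare4.Theorems.ShadowApproximation.Negative

set_option linter.dupNamespace false

open Literature.Topology.FourManifolds
open Summit.SmoothPoincare4.SmoothPoincare4.Theses.CongruenceShadows

/-! ## Which fields of `IsGroupTrisection` the junk triple violates

`J = (N₀, N₁, J₂)` satisfies `normal`, `free_quotient 0, 1`, `free_pairQuotient (0,1)` AND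
`(1,2)`, and `triple` (`S₃ ⧸ ⟪J₀ ∪ J₁ ∪ J₂⟫ = 1`); it violates exactly `free_quotient 2` and
`free_pairQuotient (0,2)` (the class of `b₀` has order `3`). So a proof of the crux must use the
freeness of `S ⧸ K₂` or of ONE pair quotient — `π₁ = 1` (the `triple` field) plus the congruence
data are still not enough. -/

section fields

/-- The word `w₄ = (b₀ · b₁ b₀ b₁⁻¹)²`: `θ w₄ = ((0 1 2)(1 2 3))² = ((0 1)(2 3))² = 1`, while its
`b₀`-exponent sum is `4`. [folklore] -/
def w4 : S := (SurfaceGroup.b 0 * (SurfaceGroup.b 1 * SurfaceGroup.b 0 * (SurfaceGroup.b 1)⁻¹)) ^ 2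

/-- `θ w₄ = 1`. [folklore] -/
theorem theta_w4 : theta w4 = 1 := by
  have e : theta w4 = (cyc * (shift * cyc * shift⁻¹)) ^ 2 := by
    simp only [w4, map_pow, map_mul, map_inv, theta_b0, theta_b1]
  rw [e]
  ext x
  by_cases hx : 0 ≤ x ∧ x ≤ 3
  · obtain ⟨h1, h2⟩ := hx
    interval_cases x <;> decide
  · simp (disch := omega) [cyc, cycAt, shift, pow_succ, Equiv.Perm.mul_apply, Equiv.Perm.inv_def,
      Equiv.addRight_symm, Equiv.swap_apply_of_ne_of_ne]

/-- `w₄ ∈ J₂`. [folklore] -/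
theorem w4_mem_J2 : w4 ∈ J2 := by
  refine Subgroup.mem_inf.2 ⟨?_, by rw [MonoidHom.mem_ker, theta_w4]⟩
  refine Subgroup.pow_mem _ (Subgroup.mul_mem _ b0_mem_N2 ?_) 2
  exact (inferInstance : (s4Kernels 2).Normal).conj_mem _ b0_mem_N2 _

/-- `b₁ ∈ N₁`. [folklore] -/
theorem b1_mem_N1 : SurfaceGroup.b 1 ∈ s4Kernels 1 := of_mem_s4Kernels 1 (by decide)

/-- KEY: `b₀ ∈ N₁ ⊔ J₂` (from `w₄ ≡ b₀⁴` modulo `N₁ ∋ b₁`, and `b₀³ ∈ J₂`). [folklore] -/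
theorem b0_mem_N1_sup_J2 : SurfaceGroup.b 0 ∈ s4Kernels 1 ⊔ J2 := by
  rw [← QuotientGroup.eq_one_iff]
  have hb1 : (QuotientGroup.mk (SurfaceGroup.b 1) : S ⧸ (s4Kernels 1 ⊔ J2)) = 1 :=
    (QuotientGroup.eq_one_iff _).2 (Subgroup.mem_sup_left b1_mem_N1)
  have hw : (QuotientGroup.mk w4 : S ⧸ (s4Kernels 1 ⊔ J2)) = 1 :=
    (QuotientGroup.eq_one_iff _).2 (Subgroup.mem_sup_right w4_mem_J2)
  have h3 : (QuotientGroup.mk (SurfaceGroup.b 0) : S ⧸ (s4Kernels 1 ⊔ J2)) ^ 3 = 1 := by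
    rw [← QuotientGroup.mk_pow, QuotientGroup.eq_one_iff]
    exact Subgroup.mem_sup_right b0_pow_three_mem_J2
  have h4 : (QuotientGroup.mk (SurfaceGroup.b 0) : S ⧸ (s4Kernels 1 ⊔ J2)) ^ 4 = 1 := by
    have : (QuotientGroup.mk w4 : S ⧸ (s4Kernels 1 ⊔ J2)) =
        (QuotientGroup.mk (SurfaceGroup.b 0) : S ⧸ (s4Kernels 1 ⊔ J2)) ^ 4 := by
      simp only [w4, QuotientGroup.mk_mul, QuotientGroup.mk_inv, hb1, one_mul,
        mul_one, inv_one, pow_succ, pow_zero, mul_assoc]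
    rw [← this, hw]
  calc (QuotientGroup.mk (SurfaceGroup.b 0) : S ⧸ (s4Kernels 1 ⊔ J2))
      = (QuotientGroup.mk (SurfaceGroup.b 0) : S ⧸ (s4Kernels 1 ⊔ J2)) ^ 4 *
          ((QuotientGroup.mk (SurfaceGroup.b 0) : S ⧸ (s4Kernels 1 ⊔ J2)) ^ 3)⁻¹ := by group
    _ = 1 := by rw [h4, h3]; group

/-- Hence `N₁ ⊔ J₂ = N₁ ⊔ N₂`: the pair `(1,2)` of the junk triple is the standard pair. [folklore] -/
theorem N1_sup_J2 : s4Kernels 1 ⊔ J2 = s4Kernels 1 ⊔ s4Kernels 2 := by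
  refine le_antisymm (sup_le_sup_left J2_le _) (sup_le le_sup_left ?_)
  refine le_trans (le_of_eq (s4Kernels_eq 2)) (Subgroup.normalClosure_le_normal ?_)
  rintro _ ⟨p, hp, rfl⟩
  have hp' : p ∈ s4Gens 2 := hp
  obtain ⟨i, b⟩ := p
  fin_cases i <;> cases b <;>
    first
    | exact absurd hp' (by decide)
    | exact b0_mem_N1_sup_J2
    | exact Subgroup.mem_sup_right (Subgroup.mem_inf.2
        ⟨of_mem_s4Kernels 2 hp', by rw [MonoidHom.mem_ker, theta_of]; simp [thetaGen]⟩)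

/-- All of `S₃` is `N₀ ⊔ N₁ ⊔ J₂`: the triple quotient of the junk triple is trivial. [folklore] -/
theorem sup_junk_eq_top : s4Kernels 0 ⊔ s4Kernels 1 ⊔ J2 = ⊤ := by
  rw [sup_assoc, N1_sup_J2, eq_top_iff, ← PresentedGroup.closure_range_of, Subgroup.closure_le]
  rintro _ ⟨p, rfl⟩
  obtain ⟨i, hi⟩ := s4Gens_cover p
  have hmem : (PresentedGroup.of p : S) ∈ s4Kernels i := of_mem_s4Kernels i hi
  fin_cases i
  · exact Subgroup.mem_sup_left hmem
  · exact Subgroup.mem_sup_right (Subgroup.mem_sup_left hmem)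
  · exact Subgroup.mem_sup_right (Subgroup.mem_sup_right hmem)

/-- The `triple` field HOLDS for the junk triple: `S₃ ⧸ ⟪J₀ ∪ J₁ ∪ J₂⟫ ≅ 1`. [folklore] -/
theorem junk_triple : Nonempty (junk.tripleQuotient ≃* (PUnit : Type)) := by
  have htop : Subgroup.normalClosure (⋃ i, (junk i : Set S)) = ⊤ := by
    rw [eq_top_iff, ← sup_junk_eq_top]
    refine sup_le (sup_le ?_ ?_) ?_
    · exact fun x hx => Subgroup.subset_normalClosure (Set.mem_iUnion.2 ⟨0, hx⟩)
    · exact fun x hx => Subgroup.subset_normalClosure (Set.mem_iUnion.2 ⟨1, hx⟩)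
    · exact fun x hx => Subgroup.subset_normalClosure (Set.mem_iUnion.2 ⟨2, hx⟩)
  haveI : Subsingleton (S ⧸ (⊤ : Subgroup S)) := ⟨fun a b => by
    obtain ⟨a, rfl⟩ := QuotientGroup.mk_surjective a
    obtain ⟨b, rfl⟩ := QuotientGroup.mk_surjective b
    exact QuotientGroup.eq.2 (Subgroup.mem_top _)⟩
  haveI : Subsingleton junk.tripleQuotient :=
    (QuotientGroup.quotientMulEquivOfEq htop).toEquiv.subsingleton_congr.2 inferInstance
  letI : Unique junk.tripleQuotient := uniqueOfSubsingleton 1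
  exact ⟨MulEquiv.ofUnique⟩

/-- For normal `A`, `B`: `⟪A ∪ B⟫ = A ⊔ B`. [folklore] -/
theorem normalClosure_union_eq_sup (A B : Subgroup S) [A.Normal] [B.Normal] :
    Subgroup.normalClosure ((A : Set S) ∪ B) = A ⊔ B :=
  le_antisymm (Subgroup.normalClosure_le_normal (Set.union_subset
      (fun _ hx => Subgroup.mem_sup_left hx) (fun _ hx => Subgroup.mem_sup_right hx)))
    (sup_le (fun _ hx => Subgroup.subset_normalClosure (Or.inl hx))
      (fun _ hx => Subgroup.subset_normalClosure (Or.inr hx)))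

/-- The `free_pairQuotient (0,1)` field holds (literally the standard pair). [folklore] -/
theorem junk_free_pairQuotient_01 : IsFreeOfRank (junk.pairQuotient 0 1) 1 :=
  s4Kernels_isGroupTrisection_holds.free_pairQuotient 0 1 (by decide)

/-- … and so does `free_pairQuotient (1,2)` (by `N1_sup_J2`). [folklore] -/
theorem junk_free_pairQuotient_12 : IsFreeOfRank (junk.pairQuotient 1 2) 1 := by
  have h := s4Kernels_isGroupTrisection_holds.free_pairQuotient 1 2 (by decide)
  refine h.of_mulEquiv (QuotientGroup.quotientMulEquivOfEq ?_)
  change Subgroup.normalClosure ((s4Kernels 1 : Set S) ∪ s4Kernels 2) =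
    Subgroup.normalClosure ((s4Kernels 1 : Set S) ∪ J2)
  rw [normalClosure_union_eq_sup, normalClosure_union_eq_sup, N1_sup_J2]

/-- … and `free_quotient 0, 1` (literally the standard data). [folklore] -/
theorem junk_free_quotient_01 (i : Fin 3) (hi : i ≠ 2) :
    IsFreeOfRank (S ⧸ Subgroup.normalClosure (junk i : Set S)) 3 := by
  fin_cases i
  · exact s4Kernels_isGroupTrisection_holds.free_quotient 0
  · exact s4Kernels_isGroupTrisection_holds.free_quotient 1
  · exact absurd rfl hi

/-- VIOLATED: `free_quotient 2` — `S₃ ⧸ J₂` has `3`-torsion. [folklore] -/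
theorem junk_not_free_quotient_two (n : ℕ) :
    ¬ IsFreeOfRank (S ⧸ Subgroup.normalClosure (junk 2 : Set S)) n := by
  rintro ⟨e⟩
  have hcl : Subgroup.normalClosure (junk 2 : Set S) = J2 := Subgroup.normalClosure_eq_self J2
  let e' : S ⧸ J2 ≃* FreeGroup (Fin n) := (QuotientGroup.quotientMulEquivOfEq hcl).symm.trans e.symm
  have hq3 : (QuotientGroup.mk (SurfaceGroup.b 0) : S ⧸ J2) ^ 3 = 1 := by
    rw [← QuotientGroup.mk_pow, QuotientGroup.eq_one_iff]; exact b0_pow_three_mem_J2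
  have hq1 : (QuotientGroup.mk (SurfaceGroup.b 0) : S ⧸ J2) ≠ 1 := by
    rw [Ne, QuotientGroup.eq_one_iff]; exact b0_not_mem_J2
  have : e' (QuotientGroup.mk (SurfaceGroup.b 0)) = 1 :=
    (pow_eq_one_iff_left three_ne_zero).1 (by rw [← map_pow, hq3, map_one])
  exact hq1 (by simpa using congrArg e'.symm this)

/-- `N₀ ≤ ker θ` (`θ` kills `a₀, a₁, b₂`). [folklore] -/
theorem N0_le_ker : s4Kernels 0 ≤ theta.ker := by
  refine le_trans (le_of_eq (s4Kernels_eq 0)) (Subgroup.normalClosure_le_normal ?_)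
  rintro _ ⟨p, hp, rfl⟩
  have hp' : p ∈ s4Gens 0 := hp
  rw [SetLike.mem_coe, MonoidHom.mem_ker, theta_of]
  obtain ⟨i, b⟩ := p
  fin_cases i <;> cases b <;> first | exact absurd hp' (by decide) | simp [thetaGen]

/-- VIOLATED: `free_pairQuotient (0,2)` — `N₀ ⊔ J₂ ≤ ker θ ∌ b₀` and `b₀³ ∈ J₂`: `3`-torsion. [folklore] -/
theorem junk_not_free_pairQuotient_02 (n : ℕ) : ¬ IsFreeOfRank (junk.pairQuotient 0 2) n := by
  rintro ⟨e⟩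
  have hPle : Subgroup.normalClosure ((junk 0 : Set S) ∪ junk 2) ≤ theta.ker := by
    refine Subgroup.normalClosure_le_normal ?_
    rintro x (hx | hx)
    · exact N0_le_ker hx
    · exact hx.2
  have hq3 : (QuotientGroup.mk (SurfaceGroup.b 0) : junk.pairQuotient 0 2) ^ 3 = 1 := by
    rw [← QuotientGroup.mk_pow, QuotientGroup.eq_one_iff]
    exact Subgroup.subset_normalClosure (Or.inr b0_pow_three_mem_J2)
  have hq1 : (QuotientGroup.mk (SurfaceGroup.b 0) : junk.pairQuotient 0 2) ≠ 1 := by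
    rw [Ne, QuotientGroup.eq_one_iff]
    intro h
    have := hPle h
    rw [MonoidHom.mem_ker, theta_b0] at this
    exact cyc_ne_one this
  have : e.symm (QuotientGroup.mk (SurfaceGroup.b 0)) = 1 :=
    (pow_eq_one_iff_left three_ne_zero).1 (by rw [← map_pow, hq3, map_one])
  have h' := congrArg e this
  rw [MulEquiv.apply_symm_apply, map_one] at h'
  exact hq1 h'

end fields

end Summit.SmoothPoincare4.SmoothPoincare4.Theorems.ShadowApproximation.Negative

end
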